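import Literature.Computability.AlgebraicComplexity.DDS21GradedFractions
import Literature.Computability.AlgebraicComplexity.DDS21EpsIntegralFractions
import HarnessLib

/-!
# DDS21 Thm. 3.2, brick B4a — `ε`-side: the Euler derivation commutes with `lim_{ε→0}`, and
# graded pieces of integral models de-border

Theorem-only companion (cell `val-lit`, np lane, DDS21 Thm 3.2 programme "M-b"; glue between
brick B4a `DDS21GradedFractions.lean` (graded pieces `gcomp`, Euler derivation `eulerFrac`) and
brick B4c (E1) `DDS21EpsIntegralFractions.lean` (t21 g13: the Gauss valuation ring `EpsLim` /
`IsEpsInt` of `F(ε)(x)`), bricks (E2)/(E3) of `HOME/np/MEMO-t21g12-DDS21-B4-DiDIL.md` §4).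
Source: P. Dutta, P. Dwivedi, N. Saxena, *Demystifying the border of depth-3 algebraic circuits*,
FOCS 2021, full version `paper:galaxy-pdf-7641649743695546420`, §3 [DuttaDwivediSaxena2022].

## Contents (all PROVED; 0 definitions, 0 named facts)

* §A graded pieces under maps of the coefficient ring (`homogeneousComponent_map'`, `hpart_map`,
  `jet_map`).
* §B **`E` commutes with `lim_{ε→0}`** (`EpsLim.eulerFrac`, `IsEpsInt.eulerFrac`,
  `IsEpsInt.lim_eulerFrac`) and the DiDIL "Divide and Derive" step on EXACT objects
  (`epsLim_eulerFrac_div`: `lim g = f`, `lim T̃ = t ≠ 0` ⇒ `lim E(g/T̃) = E(f/t)`) — the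
  one-step `ε`-side content of Claims 3.4 and 3.5 (ii) (p0029 L772–785, p0031 L815–834) in the
  frame of lead-np RULING (132)(a) (memo findings F3/R1: exact objects, no truncation); the
  chain over the stages is x5 g8's `DDS21DiDILExactChain.lean` (RULING (135)(c)).
* §C **graded pieces of integral models de-border** (`gcomp_redZero_mem_border`): a `Σ∧Σ(t,e)`
  certificate for the degree-`c` piece of `p̂/Q̂` over `F(ε)` (`p̂, Q̂ ∈ F[ε][x]`,
  `Q̂(0)|_{ε=0} ≠ 0`) puts the degree-`c` piece of `p̂(0)/Q̂(0)` over `F` in `\overline{Σ∧Σ(t,e)}`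
  — the componentwise form of "`lim_{ε→0} Σ∧Σ ⊆ \overline{Σ∧Σ}`" in the proof of Claim 3.3
  (p0027 L737–748), via the division-free formula `C_pow_mul_gcomp` / `map_adjJet` of B4a and
  `map_constantCoeff_mem_border` (t19).

Honest framing: `ε`-bookkeeping for one brick; `DDS2021_thm_3_2` stays OPEN by name; VP ≠ VNP
is NOT proved and nothing here bears on it.

## References

* [DuttaDwivediSaxena2022] P. Dutta, P. Dwivedi, N. Saxena, *Demystifying the border of depth-3
  algebraic circuits*, Proc. 62nd FOCS (2021), IEEE 2022, 92–103; full version §3: Claim 3.3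
  proof (p0027 L724–748), Claim 3.4 (p0029 L772–785), induction hypotheses (p0030 L799–812),
  Claim 3.5 (p0031 L815–834).
-/

noncomputable section

open MvPolynomial
open scoped BigOperators Polynomial

namespace Literature.Computability.AlgebraicComplexity

namespace DDS2021

/-! ## §A Graded pieces under maps of the coefficient ring

Extension of scalars `F ↪ F(ε)` and reduction `F[ε] → F` (`ε = 0`) act coefficientwise, hence
commute with homogeneous parts, jets and the Euler derivation; for a fraction with unit
denominator the division-free formula `C_pow_mul_gcomp` transports the graded pieces. -/

section Maps

variable {σ : Type*} [Fintype σ] [DecidableEq σ] {R S : Type*} [CommSemiring R] [CommSemiring S]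

omit [Fintype σ] [DecidableEq σ] in
/-- Homogeneous components commute with maps of the coefficient ring.
[cite: DuttaDwivediSaxena2022, Def. 2.1 (full version p0016 L416–419)] -/
theorem homogeneousComponent_map' (f : R →+* S) (c : ℕ) (p : MvPolynomial σ R) :
    homogeneousComponent c (map f p) = map f (homogeneousComponent c p) := by
  ext d
  rw [coeff_homogeneousComponent, coeff_map, coeff_map, coeff_homogeneousComponent]
  split_ifs with h
  · rfl
  · rw [map_zero]

/-- Homogeneous parts of power series commute with maps of the coefficient ring.
[cite: DuttaDwivediSaxena2022, Def. 2.1 (full version p0016 L416–419)] -/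
theorem hpart_map (f : R →+* S) (c : ℕ) (φ : MvPowerSeries σ R) :
    hpart c (MvPowerSeries.map f φ) = map f (hpart c φ) :=
  MvPowerSeries.truncFinset_map f φ

/-- Jets commute with maps of the coefficient ring. [cite: DuttaDwivediSaxena2022, Def. 2.1 (full version p0016 L416–419)] -/
theorem jet_map (f : R →+* S) (N : ℕ) (φ : MvPowerSeries σ R) :
    jet N (MvPowerSeries.map f φ) = map f (jet N φ) :=
  MvPowerSeries.truncFinset_map f φ

end Maps

/-! ## §B The Euler derivation commutes with `lim_{ε→0}` (exact form of Claims 3.4 / 3.5(ii))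

"`lim_{ε→0} g_1 = lim_{ε→0} ∂_z(g_0/T̃) = ∂_z(Φ(f_0)/t)`" (Claim 3.4 proof, p0029 L775–779): on the
Gauss valuation ring of `F(ε)(x)` (t21 g13's `EpsLim`), the Euler derivation of `F(ε)(x)` maps
`ε`-integral elements to `ε`-integral elements and commutes with the residue map; combined with
`EpsLim.div` this is the DiDIL "Divide and Derive" step on exact objects (memo R1). -/

section EulerLim

variable {F : Type*} [Field F] {σ : Type*}

/-- Reduction at `ε = 0` commutes with the Euler derivation.
[cite: DuttaDwivediSaxena2022, Claim 3.4 proof (full version p0029 L775–779)] -/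
theorem redZero_euler (G : MvPolynomial σ F[X]) :
    redZero F σ (euler σ F[X] G) = euler σ F (redZero F σ G) := by
  rw [redZero_apply, redZero_apply, euler_map]

/-- The Euler derivation of `F(ε)(x)` on an integral model.
[cite: DuttaDwivediSaxena2022, Claim 3.4 proof (full version p0029 L775–779)] -/
theorem eulerFrac_intToFrac (G : MvPolynomial σ F[X]) :
    eulerFrac σ (RatFunc F) (FractionRing (MvPolynomial σ (RatFunc F))) (intToFrac F σ G) =
      intToFrac F σ (euler σ F[X] G) := by
  rw [intToFrac_apply, intToFrac_apply, eulerFrac_algebraMap, euler_map]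

/-- The Euler derivation of `F(x)` on a polynomial. [cite: DuttaDwivediSaxena2022, Claim 3.4 proof (full version p0029 L775–779)] -/
theorem eulerFrac_limToFrac (f : MvPolynomial σ F) :
    eulerFrac σ F (FractionRing (MvPolynomial σ F)) (limToFrac F σ f) = limToFrac F σ (euler σ F f) := by
  rw [limToFrac_apply, limToFrac_apply, eulerFrac_algebraMap]

/-- **`E` commutes with `lim_{ε→0}`**: if `T ∈ F(ε)(x)` is `ε`-integral with limit `r ∈ F(x)`,
then `E T` is `ε`-integral with limit `E r` — "`lim_{ε→0} ∂_z(g_0/T̃) = ∂_z(Φ(f_0)/t)`" in the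
graded frame, for exact objects (quotient rule on a model `M/E`, `E(0) ≠ 0`: new model
`(E M · E − M · E E)/E²`). [cite: DuttaDwivediSaxena2022, Claim 3.4 proof (full version p0029 L772–785); Claim 3.5 (ii) (p0031 L815–834)] -/
theorem EpsLim.eulerFrac {T : FractionRing (MvPolynomial σ (RatFunc F))}
    {r : FractionRing (MvPolynomial σ F)} (h : EpsLim T r) :
    EpsLim (DDS2021.eulerFrac σ (RatFunc F) _ T) (DDS2021.eulerFrac σ F _ r) := by
  obtain ⟨M, E, hE, hT, hr⟩ := h
  have hE0 : E ≠ 0 := ne_zero_of_redZero_ne_zero hE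
  have hiE : intToFrac F σ E ≠ 0 := intToFrac_ne_zero hE0
  have hlE : limToFrac F σ (redZero F σ E) ≠ 0 := limToFrac_ne_zero hE
  refine ⟨euler σ F[X] M * E - M * euler σ F[X] E, E * E, ?_, ?_, ?_⟩
  · rw [map_mul]; exact mul_ne_zero hE hE
  · have hT' : T = intToFrac F σ M / intToFrac F σ E := by
      rw [eq_div_iff hiE, hT]
    rw [hT', eulerFrac_div, eulerFrac_intToFrac, eulerFrac_intToFrac]
    simp only [← map_mul, ← map_sub, sq]
    exact div_mul_cancel₀ _ (by rw [map_mul]; exact mul_ne_zero hiE hiE)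
  · have hr' : r = limToFrac F σ (redZero F σ M) / limToFrac F σ (redZero F σ E) := by
      rw [eq_div_iff hlE, hr]
    rw [hr', eulerFrac_div, eulerFrac_limToFrac, eulerFrac_limToFrac, ← redZero_euler,
      ← redZero_euler]
    simp only [← map_mul, ← map_sub, sq]
    exact div_mul_cancel₀ _ (by rw [map_mul, map_mul]; exact mul_ne_zero hlE hlE)

/-- `E` preserves `ε`-integrality. [cite: DuttaDwivediSaxena2022, Claim 3.4 proof (full version p0029 L772–785)] -/
theorem IsEpsInt.eulerFrac {T : FractionRing (MvPolynomial σ (RatFunc F))} (h : IsEpsInt T) :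
    IsEpsInt (DDS2021.eulerFrac σ (RatFunc F) _ T) :=
  h.epsLim_lim.eulerFrac.isEpsInt

/-- The limit of `E T` is `E (lim T)`. [cite: DuttaDwivediSaxena2022, Claim 3.4 proof (full version p0029 L772–785)] -/
theorem IsEpsInt.lim_eulerFrac {T : FractionRing (MvPolynomial σ (RatFunc F))} (h : IsEpsInt T) :
    h.eulerFrac.lim = DDS2021.eulerFrac σ F _ h.lim :=
  h.eulerFrac.epsLim_lim.unique h.epsLim_lim.eulerFrac

/-- **The DiDIL step on exact objects ("Divide and Derive")**: if `g` approximates `f`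
(`lim g = f`), the divisor `T̃` has a NONZERO limit `t`, then `E(g/T̃)` is `ε`-integral with limit
`E(f/t)` — the exact form of Claim 3.4 ("`lim_{ε→0} g_1 = ∂_z(Φ(f_0)/t) =: f_1`") and of
Claim 3.5 (ii) at every stage (memo F3/R1: with exact objects no truncation and no precision
bookkeeping is needed on the `ε`-side). [cite: DuttaDwivediSaxena2022, Claim 3.4 (full version p0029 L772–785); Claim 3.5 (ii) (p0031 L815–834)] -/
theorem epsLim_eulerFrac_div {g T : FractionRing (MvPolynomial σ (RatFunc F))}
    {f t : FractionRing (MvPolynomial σ F)} (hg : EpsLim g f) (hT : EpsLim T t) (ht : t ≠ 0) :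
    EpsLim (eulerFrac σ (RatFunc F) _ (g / T)) (eulerFrac σ F _ (f / t)) :=
  (hg.div hT ht).eulerFrac

end EulerLim

/-! ## §C Graded pieces of integral models de-border (componentwise Claim 3.3)

For integral models `p̂, Q̂ ∈ F[ε][x]` with `Q̂(0)|_{ε=0} ≠ 0`, the graded piece of `p̂/Q̂` over
`F(ε)` is, up to the `ε`-unit `Q̂(0)^{c+1}`, the image of the POLYNOMIAL `(p̂ · adjJet c Q̂)_c`
whose reduction at `ε = 0` is `Q̂(0)(0)^{c+1} ·` the graded piece of `p̂(0)/Q̂(0)` over `F`.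
Hence a `Σ∧Σ` certificate for the piece over `F(ε)` de-borders to `\overline{Σ∧Σ}` membership
of the piece over `F` ("`lim_{ε→0} Σ∧Σ = \overline{Σ∧Σ}`", Claim 3.3 proof, p0027 L744–748),
which the tree's `uabpComputes_of_mem_border_swsClass` (B2b) turns into an ABP. -/

section Deborder

variable {F : Type*} [Field F] {n : ℕ}

/-- The graded piece of an integral model, cleared by the `ε`-unit `Q̂(0)^{c+1}`, is the image
of an integral polynomial. [cite: DuttaDwivediSaxena2022, Claim 3.3 proof (full version p0027 L737–748)] -/
theorem C_pow_mul_gcomp_map (p Q : MvPolynomial (Fin n) F[X])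
    (hQ : coeff 0 (map (algebraMap F[X] (RatFunc F)) Q) ≠ 0) (c : ℕ) :
    C (algebraMap F[X] (RatFunc F) (coeff 0 Q) ^ (c + 1)) *
        gcomp (map (algebraMap F[X] (RatFunc F)) p) (map (algebraMap F[X] (RatFunc F)) Q) c =
      map (algebraMap F[X] (RatFunc F)) (homogeneousComponent c (p * adjJet c Q)) := by
  rw [← homogeneousComponent_map', map_mul, map_adjJet, ← C_pow_mul_gcomp hQ, coeff_map]

/-- Its reduction at `ε = 0` is `Q̂(0)(0)^{c+1} ·` the graded piece of the reductions.
[cite: DuttaDwivediSaxena2022, Claim 3.3 proof (full version p0027 L737–748)] -/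
theorem redZero_homogeneousComponent_mul_adjJet (p Q : MvPolynomial (Fin n) F[X])
    (hQ : coeff 0 (redZero F (Fin n) Q) ≠ 0) (c : ℕ) :
    redZero F (Fin n) (homogeneousComponent c (p * adjJet c Q)) =
      C ((coeff 0 Q).coeff 0 ^ (c + 1)) * gcomp (redZero F (Fin n) p) (redZero F (Fin n) Q) c := by
  rw [redZero_apply, ← homogeneousComponent_map', map_mul, map_adjJet, ← redZero_apply,
    ← redZero_apply, ← C_pow_mul_gcomp hQ]
  congr 3

/-- A unit constant coefficient at `ε = 0` is a unit over `F(ε)`. [cite: DuttaDwivediSaxena2022, Claim 3.3 proof (full version p0027 L737–748)] -/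
theorem coeff_zero_map_ne_zero_of_redZero {Q : MvPolynomial (Fin n) F[X]}
    (hQ : coeff 0 (redZero F (Fin n) Q) ≠ 0) :
    coeff 0 (map (algebraMap F[X] (RatFunc F)) Q) ≠ 0 := by
  simp only [redZero_apply, coeff_map, Polynomial.constantCoeff_apply] at hQ ⊢
  exact (map_ne_zero_iff _ (RatFunc.algebraMap_injective F)).2 fun h0 => hQ (by
    rw [h0, Polynomial.coeff_zero])

/-- **Graded pieces de-border**: a `Σ∧Σ(t,e)` certificate for the degree-`c` piece of
`p̂/Q̂` over `F(ε)` (integral models, `Q̂(0)|_{ε=0} ≠ 0`) puts the degree-`c` piece of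
`p̂(0)/Q̂(0)` over `F` in `\overline{Σ∧Σ(t,e)}` ("`lim_{ε→0} Σ∧Σ ⊆ \overline{Σ∧Σ} ⊆ ARO ⊆ ABP`",
Claim 3.3 proof) — feed it to `uabpComputes_of_mem_border_swsClass`.
[cite: DuttaDwivediSaxena2022, Claim 3.3 proof (full version p0027 L737–748)] -/
theorem gcomp_redZero_mem_border {t e : ℕ} {p Q : MvPolynomial (Fin n) F[X]}
    (hQ : coeff 0 (redZero F (Fin n) Q) ≠ 0) {c : ℕ}
    (hc : gcomp (map (algebraMap F[X] (RatFunc F)) p) (map (algebraMap F[X] (RatFunc F)) Q) c ∈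
      swsClass (RatFunc F) n t e) :
    gcomp (redZero F (Fin n) p) (redZero F (Fin n) Q) c ∈ border (swsClass (RatFunc F) n t e) := by
  set a : F := (coeff 0 Q).coeff 0 with ha
  have ha0 : a ≠ 0 := by rwa [ha, ← Polynomial.constantCoeff_apply, ← coeff_map, ← redZero_apply]
  -- the integral polynomial `G := (p · adjJet c Q)_c` has `map ι G ∈ Σ∧Σ` and reduces to `a^{c+1} · piece`
  have hG : map (algebraMap F[X] (RatFunc F)) (homogeneousComponent c (p * adjJet c Q)) ∈
      swsClass (RatFunc F) n t e := by
    rw [← C_pow_mul_gcomp_map p Q (coeff_zero_map_ne_zero_of_redZero hQ) c]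
    exact C_mul_mem_swsClass _ hc
  have hb := map_constantCoeff_mem_border hG
  rw [← redZero_apply, redZero_homogeneousComponent_mul_adjJet p Q hQ, ← ha] at hb
  -- divide by the nonzero scalar `a^{c+1}`
  obtain ⟨g, hg, hfg⟩ := hb
  refine ⟨C (algebraMap F[X] (RatFunc F) (Polynomial.C (a ^ (c + 1))⁻¹)) * g,
    C_mul_mem_swsClass _ hg, ?_⟩
  obtain ⟨G, hGg, hGf⟩ := isEpsApprox_iff_exists_map.mp hfg
  refine isEpsApprox_iff_exists_map.mpr ⟨C (Polynomial.C (a ^ (c + 1))⁻¹) * G, ?_, ?_⟩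
  · rw [map_mul, map_C, hGg]
  · rw [map_mul, map_C, hGf, Polynomial.constantCoeff_apply, Polynomial.coeff_C_zero,
      ← mul_assoc, ← map_mul, inv_mul_cancel₀ (pow_ne_zero _ ha0), map_one, one_mul]

end Deborder

end DDS2021

end Literature.Computability.AlgebraicComplexity

end
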